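import Summits.QuantumFields.YangMills.Theorems.VirialFluxGapCentralProjectionDefs
import HarnessLib

/-!
# Route `VirialFluxGap` (YangMills): the CONE INEQUALITY for block data — every finite family of vectors in `ℝ³` is within
# `√(#ι·2Q₁)/|z|` of a COLLINEAR (commuting) family, `Q₁ = Σ_{μ<ν} |z_μ × z_ν|²` (eigenvalue-free; LEAD g92 note №6 (ii))

Toward the deciding crux ⟨stmt-QuantumFields-24141⟩ `VirialFluxGap.PeriodicSoftness`, central charts (C1).  By ✓`FrameDerivative.ringDeficit_centralProj`
(w3 g58) the deficit of the central projection `π_C P` is the explicit quartic `2L²·Σ_{k<l} 4·lag(z_k,z_l) + L²·Σ_k 4·lag(z_k,z₄)` of the block data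
`z_k = blockIm (wrapBlock k) k P`, `z₄ = seamIm P ∈ ℝ³`, where `lag(a,b) = |a|²|b|² − (a·b)² = |a × b|²` is the Lagrange form; its zero set is the cone
`C₀` of COLLINEAR data (all `z_μ` on one axis = pairwise commuting imaginary quaternions).  The central-coercivity plan (LEAD g92, note №6 on the
ym-idea-1 bus, steps (ii)–(iii)) needs the distance to `C₀` controlled by the quartic: `d(z)² ≤ C·Q₁(z)/|z|²`.  This file proves it WITHOUT eigenvalues:
take the axis of the LONGEST `z_μ`.

* §1 the Lagrange form written out: `lagrange_eq_sq_sum` (`= Σ` of the three `2×2` minors squared), `lagrange_nonneg`, `lagrange_comm`, `lagrange_self`,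
  ★ `dist_line_sq` — `|z − ((z·a)/(a·a))·a|² = lag(z,a)/(a·a)` (squared distance to the axis `ℝa`);
* §2 ★★ `exists_axis_row_le` — an index `m` with `|z_μ| ≤ |z_m|` for all `μ` and `Σ_μ lag(z_μ,z_m) ≤ Σ_μ Σ_ν lag(z_μ,z_ν)`;
  ★★★ `exists_collinear_near` — `∃ a t, (Σ_μ |z_μ − t_μ·a|²)·(Σ_μ |z_μ|²) ≤ #ι · Σ_μ Σ_ν lag(z_μ,z_ν)`, i.e. `d(z)²·|z|² ≤ #ι·2Q₁(z)`
  (for `#ι = 4`: `d² ≤ 8Q₁/|z|²`);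
* §3 ★★ `exists_collinear_near_centralProj` — in w3's letters: the four block data of ANY ring history `P` satisfy
  `d(z)²·|z|²·L² ≤ 2·F₀(π_C P)` (`sum_pairs_fin3` expands the pair sum of ✓`ringDeficit_centralProj`; `double_sum_le_weighted_quartic`).

HONEST FRAMING: Euclidean-geometry helper (theorems only, 0 `def`, 0 `sorry`, standard axioms); the central coercivity, the exact `g₂ ∕ H(z)` and the
central charts are NOT here; ⟨24141⟩ and ⟨22884⟩ stay OPEN; no stub ∕ crux ∕ rung ∕ summit is closed; the Yang–Mills mass gap is NOT proved; no summit
is proved by a line.  Width seat `ym-line-sfw-p2-w2` g52 (cell ym-idea-1, free hands), `--supports stmt-QuantumFields-24141`.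
References: [cite: CosteEtAl1985] (quartic zero-mode potential, toron valley); [cite: Luscher1983, §2]; [folklore] (Lagrange identity).
-/

set_option autoImplicit false

noncomputable section

open scoped Matrix BigOperators
open Literature.MathematicalPhysics.QuantumFieldTheory hiding SU2
open Literature.MathematicalPhysics.QuantumLattice

namespace Summit.QuantumFields.YangMills.Theorems.VirialFluxGap.BlockCone

open Summit.QuantumFields.YangMills.Theorems.FemtoTransferGap
open Summit.QuantumFields.YangMills.Theorems.VirialFluxGap.RingDeficit
open Summit.QuantumFields.YangMills.Theorems.VirialFluxGap.FrameDerivative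

/-! ## §1 The Lagrange form `lag(a,b) = (a·a)(b·b) − (a·b)²` on `ℝ³` -/

/-- ★ **Lagrange's identity in `ℝ³`**: `(a·a)(b·b) − (a·b)² = Σ_{i<j} (a_ib_j − a_jb_i)²` (`= |a × b|²`). [folklore] -/
theorem lagrange_eq_sq_sum (a b : Fin 3 → ℝ) :
    (a ⬝ᵥ a) * (b ⬝ᵥ b) - (a ⬝ᵥ b) ^ 2 =
      (a 0 * b 1 - a 1 * b 0) ^ 2 + (a 0 * b 2 - a 2 * b 0) ^ 2 + (a 1 * b 2 - a 2 * b 1) ^ 2 := by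
  simp only [dotProduct, Fin.sum_univ_three]
  ring

/-- The Lagrange form is non-negative (Cauchy–Schwarz in `ℝ³`). [folklore] -/
theorem lagrange_nonneg (a b : Fin 3 → ℝ) : 0 ≤ (a ⬝ᵥ a) * (b ⬝ᵥ b) - (a ⬝ᵥ b) ^ 2 := by
  rw [lagrange_eq_sq_sum]
  positivity

/-- The Lagrange form is symmetric. [folklore] -/
theorem lagrange_comm (a b : Fin 3 → ℝ) :
    (a ⬝ᵥ a) * (b ⬝ᵥ b) - (a ⬝ᵥ b) ^ 2 = (b ⬝ᵥ b) * (a ⬝ᵥ a) - (b ⬝ᵥ a) ^ 2 := by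
  rw [dotProduct_comm a b]
  ring

/-- The Lagrange form vanishes on the diagonal. [folklore] -/
theorem lagrange_self (a : Fin 3 → ℝ) : (a ⬝ᵥ a) * (a ⬝ᵥ a) - (a ⬝ᵥ a) ^ 2 = 0 := by
  ring

/-- ★ **Squared distance to an axis**: for `a ≠ 0`, the foot of `z` on the line `ℝ·a` is `((z·a)/(a·a))·a` and
`|z − ((z·a)/(a·a))·a|² = lag(z,a)/(a·a)`. [folklore] -/
theorem dist_line_sq (z a : Fin 3 → ℝ) (ha : a ⬝ᵥ a ≠ 0) :
    (z - ((z ⬝ᵥ a) / (a ⬝ᵥ a)) • a) ⬝ᵥ (z - ((z ⬝ᵥ a) / (a ⬝ᵥ a)) • a) =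
      ((z ⬝ᵥ z) * (a ⬝ᵥ a) - (z ⬝ᵥ a) ^ 2) / (a ⬝ᵥ a) := by
  simp only [sub_dotProduct, dotProduct_sub, smul_dotProduct, dotProduct_smul, smul_eq_mul]
  rw [dotProduct_comm a z]
  field_simp
  ring

/-! ## §2 The cone inequality: a finite family is close to the axis of its longest member -/

variable {ι : Type*} [Fintype ι]

/-- ★★ **The axis of the longest vector**: there is an index `m` with `|z_μ| ≤ |z_m|` for all `μ`, and the transversal defect of the whole
family relative to the axis `z_m` is at most the double Lagrange sum: `Σ_μ lag(z_μ,z_m) ≤ Σ_μ Σ_ν lag(z_μ,z_ν)` (it is one row of it). [folklore] -/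
theorem exists_axis_row_le [Nonempty ι] (z : ι → Fin 3 → ℝ) :
    ∃ m : ι, (∀ μ, z μ ⬝ᵥ z μ ≤ z m ⬝ᵥ z m) ∧
      ∑ μ, ((z μ ⬝ᵥ z μ) * (z m ⬝ᵥ z m) - (z μ ⬝ᵥ z m) ^ 2) ≤
        ∑ μ, ∑ ν, ((z μ ⬝ᵥ z μ) * (z ν ⬝ᵥ z ν) - (z μ ⬝ᵥ z ν) ^ 2) := by
  obtain ⟨m, hm⟩ := Finite.exists_max fun μ => z μ ⬝ᵥ z μ
  refine ⟨m, hm, ?_⟩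
  calc ∑ μ, ((z μ ⬝ᵥ z μ) * (z m ⬝ᵥ z m) - (z μ ⬝ᵥ z m) ^ 2)
      = ∑ ν, ((z m ⬝ᵥ z m) * (z ν ⬝ᵥ z ν) - (z m ⬝ᵥ z ν) ^ 2) := Finset.sum_congr rfl fun ν _ => lagrange_comm _ _
    _ ≤ ∑ μ, ∑ ν, ((z μ ⬝ᵥ z μ) * (z ν ⬝ᵥ z ν) - (z μ ⬝ᵥ z ν) ^ 2) :=
        Finset.single_le_sum (f := fun μ => ∑ ν, ((z μ ⬝ᵥ z μ) * (z ν ⬝ᵥ z ν) - (z μ ⬝ᵥ z ν) ^ 2))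
          (fun μ _ => Finset.sum_nonneg fun ν _ => lagrange_nonneg _ _) (Finset.mem_univ m)

/-- ★★★ **THE CONE INEQUALITY (eigenvalue-free).**  Every finite family `z : ι → ℝ³` admits an axis `a` and scalars `t_μ` with
`(Σ_μ |z_μ − t_μ·a|²) · (Σ_μ |z_μ|²) ≤ #ι · Σ_μ Σ_ν lag(z_μ,z_ν)`: the squared distance `d(z)²` to the cone of COLLINEAR families (= commuting
imaginary quaternions) satisfies `d(z)² ≤ #ι·2Q₁(z)/|z|²`, `Q₁ = Σ_{μ<ν} lag(z_μ,z_ν)` (axis: the longest `z_μ`, whose squared length is `≥ |z|²/#ι`).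
For the four block data of the central chart (`#ι = 4`) this is LEAD g92's note №6 (ii) lower half `d² ≤ C·Q₁/|z|²`. [cite: CosteEtAl1985] -/
theorem exists_collinear_near [Nonempty ι] (z : ι → Fin 3 → ℝ) :
    ∃ (a : Fin 3 → ℝ) (t : ι → ℝ),
      (∑ μ, (z μ - t μ • a) ⬝ᵥ (z μ - t μ • a)) * (∑ μ, z μ ⬝ᵥ z μ) ≤
        (Fintype.card ι : ℝ) * ∑ μ, ∑ ν, ((z μ ⬝ᵥ z μ) * (z ν ⬝ᵥ z ν) - (z μ ⬝ᵥ z ν) ^ 2) := by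
  obtain ⟨m, hm, hrow⟩ := exists_axis_row_le z
  have hnn : ∀ a : Fin 3 → ℝ, 0 ≤ a ⬝ᵥ a := fun a => Finset.sum_nonneg fun i _ => mul_self_nonneg (a i)
  have hQ : 0 ≤ ∑ μ, ∑ ν, ((z μ ⬝ᵥ z μ) * (z ν ⬝ᵥ z ν) - (z μ ⬝ᵥ z ν) ^ 2) :=
    Finset.sum_nonneg fun μ _ => Finset.sum_nonneg fun ν _ => lagrange_nonneg _ _
  have hS : ∑ μ, z μ ⬝ᵥ z μ ≤ (Fintype.card ι : ℝ) * (z m ⬝ᵥ z m) := by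
    calc ∑ μ, z μ ⬝ᵥ z μ ≤ ∑ _μ : ι, z m ⬝ᵥ z m := Finset.sum_le_sum fun μ _ => hm μ
      _ = (Fintype.card ι : ℝ) * (z m ⬝ᵥ z m) := by rw [Finset.sum_const, Finset.card_univ, nsmul_eq_mul]
  by_cases hA : z m ⬝ᵥ z m = 0
  · -- the longest vector is `0`: the whole family is `0`
    refine ⟨0, fun _ => 0, ?_⟩
    have hS0 : ∑ μ, z μ ⬝ᵥ z μ = 0 := by
      refine le_antisymm ?_ (Finset.sum_nonneg fun μ _ => hnn _)
      rw [hA, mul_zero] at hS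
      exact hS
    rw [hS0, mul_zero]
    exact mul_nonneg (Nat.cast_nonneg _) hQ
  · have hA0 : 0 < z m ⬝ᵥ z m := lt_of_le_of_ne (hnn _) (Ne.symm hA)
    refine ⟨z m, fun μ => (z μ ⬝ᵥ z m) / (z m ⬝ᵥ z m), ?_⟩
    have hdist : ∑ μ, (z μ - ((z μ ⬝ᵥ z m) / (z m ⬝ᵥ z m)) • z m) ⬝ᵥ (z μ - ((z μ ⬝ᵥ z m) / (z m ⬝ᵥ z m)) • z m) =
        (∑ μ, ((z μ ⬝ᵥ z μ) * (z m ⬝ᵥ z m) - (z μ ⬝ᵥ z m) ^ 2)) / (z m ⬝ᵥ z m) := by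
      rw [Finset.sum_div]
      exact Finset.sum_congr rfl fun μ _ => dist_line_sq _ _ hA
    rw [hdist]
    have hD0 : 0 ≤ ∑ μ, ((z μ ⬝ᵥ z μ) * (z m ⬝ᵥ z m) - (z μ ⬝ᵥ z m) ^ 2) := Finset.sum_nonneg fun μ _ => lagrange_nonneg _ _
    calc (∑ μ, ((z μ ⬝ᵥ z μ) * (z m ⬝ᵥ z m) - (z μ ⬝ᵥ z m) ^ 2)) / (z m ⬝ᵥ z m) * ∑ μ, z μ ⬝ᵥ z μ
        ≤ (∑ μ, ((z μ ⬝ᵥ z μ) * (z m ⬝ᵥ z m) - (z μ ⬝ᵥ z m) ^ 2)) / (z m ⬝ᵥ z m) * ((Fintype.card ι : ℝ) * (z m ⬝ᵥ z m)) :=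
          mul_le_mul_of_nonneg_left hS (div_nonneg hD0 hA0.le)
      _ = (Fintype.card ι : ℝ) * ∑ μ, ((z μ ⬝ᵥ z μ) * (z m ⬝ᵥ z m) - (z μ ⬝ᵥ z m) ^ 2) := by
          rw [mul_comm (Fintype.card ι : ℝ) (z m ⬝ᵥ z m), ← mul_assoc, div_mul_cancel₀ _ hA, mul_comm]
      _ ≤ (Fintype.card ι : ℝ) * ∑ μ, ∑ ν, ((z μ ⬝ᵥ z μ) * (z ν ⬝ᵥ z ν) - (z μ ⬝ᵥ z ν) ^ 2) :=
          mul_le_mul_of_nonneg_left hrow (Nat.cast_nonneg _)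

/-- The collinear family `w_μ = t_μ·a` produced by `exists_collinear_near` is pairwise commuting data: `lag(w_μ,w_ν) = 0`. [folklore] -/
theorem lagrange_smul_smul (a : Fin 3 → ℝ) (s t : ℝ) :
    ((s • a) ⬝ᵥ (s • a)) * ((t • a) ⬝ᵥ (t • a)) - ((s • a) ⬝ᵥ (t • a)) ^ 2 = 0 := by
  simp only [smul_dotProduct, dotProduct_smul, smul_eq_mul]
  ring

/-! ## §3 The block data of a ring history are close to commuting data, quantitatively through `F₀ ∘ π_C` -/

/-- The index set of pairs `k < l` in `Fin 3`. [folklore] -/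
theorem univ_pairs_fin3 :
    (Finset.univ : Finset {p : Fin 3 × Fin 3 // p.1 < p.2}) =
      {⟨((0 : Fin 3), (1 : Fin 3)), by decide⟩, ⟨((0 : Fin 3), (2 : Fin 3)), by decide⟩, ⟨((1 : Fin 3), (2 : Fin 3)), by decide⟩} := by
  decide

/-- The pair sum over `{(k,l) : k < l}` in `Fin 3` written out. [folklore] -/
theorem sum_pairs_fin3 (f : {p : Fin 3 × Fin 3 // p.1 < p.2} → ℝ) :
    ∑ p, f p = f ⟨((0 : Fin 3), (1 : Fin 3)), by decide⟩ + f ⟨((0 : Fin 3), (2 : Fin 3)), by decide⟩ + f ⟨((1 : Fin 3), (2 : Fin 3)), by decide⟩ := by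
  rw [univ_pairs_fin3, Finset.sum_insert (by decide), Finset.sum_insert (by decide), Finset.sum_singleton]
  ring

/-- The weighted pair quartic of four vectors (spatial pairs weight `2c`, seam pairs weight `c`, each Lagrange form times `4`, as in
✓`ringDeficit_centralProj` with `c = L²`) dominates `2c·Σ_μΣ_ν lag`. [folklore] -/
theorem double_sum_le_weighted_quartic (b₀ b₁ b₂ s : Fin 3 → ℝ) {c : ℝ} (hc : 0 ≤ c) :
    4 * (∑ μ : Fin 4, ∑ ν : Fin 4, (((![b₀, b₁, b₂, s] : Fin 4 → Fin 3 → ℝ) μ ⬝ᵥ (![b₀, b₁, b₂, s] : Fin 4 → Fin 3 → ℝ) μ) *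
        ((![b₀, b₁, b₂, s] : Fin 4 → Fin 3 → ℝ) ν ⬝ᵥ (![b₀, b₁, b₂, s] : Fin 4 → Fin 3 → ℝ) ν) -
        ((![b₀, b₁, b₂, s] : Fin 4 → Fin 3 → ℝ) μ ⬝ᵥ (![b₀, b₁, b₂, s] : Fin 4 → Fin 3 → ℝ) ν) ^ 2)) * c ≤
      2 * (2 * c * (4 * ((b₀ 0 * b₀ 0 + b₀ 1 * b₀ 1 + b₀ 2 * b₀ 2) * (b₁ 0 * b₁ 0 + b₁ 1 * b₁ 1 + b₁ 2 * b₁ 2) -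
              (b₀ 0 * b₁ 0 + b₀ 1 * b₁ 1 + b₀ 2 * b₁ 2) ^ 2) +
            4 * ((b₀ 0 * b₀ 0 + b₀ 1 * b₀ 1 + b₀ 2 * b₀ 2) * (b₂ 0 * b₂ 0 + b₂ 1 * b₂ 1 + b₂ 2 * b₂ 2) -
              (b₀ 0 * b₂ 0 + b₀ 1 * b₂ 1 + b₀ 2 * b₂ 2) ^ 2) +
            4 * ((b₁ 0 * b₁ 0 + b₁ 1 * b₁ 1 + b₁ 2 * b₁ 2) * (b₂ 0 * b₂ 0 + b₂ 1 * b₂ 1 + b₂ 2 * b₂ 2) -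
              (b₁ 0 * b₂ 0 + b₁ 1 * b₂ 1 + b₁ 2 * b₂ 2) ^ 2)) +
          c * (4 * ((b₀ 0 * b₀ 0 + b₀ 1 * b₀ 1 + b₀ 2 * b₀ 2) * (s 0 * s 0 + s 1 * s 1 + s 2 * s 2) -
              (b₀ 0 * s 0 + b₀ 1 * s 1 + b₀ 2 * s 2) ^ 2) +
            4 * ((b₁ 0 * b₁ 0 + b₁ 1 * b₁ 1 + b₁ 2 * b₁ 2) * (s 0 * s 0 + s 1 * s 1 + s 2 * s 2) -
              (b₁ 0 * s 0 + b₁ 1 * s 1 + b₁ 2 * s 2) ^ 2) +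
            4 * ((b₂ 0 * b₂ 0 + b₂ 1 * b₂ 1 + b₂ 2 * b₂ 2) * (s 0 * s 0 + s 1 * s 1 + s 2 * s 2) -
              (b₂ 0 * s 0 + b₂ 1 * s 1 + b₂ 2 * s 2) ^ 2))) := by
  have dotProduct_fin3 : ∀ a b : Fin 3 → ℝ, a ⬝ᵥ b = a 0 * b 0 + a 1 * b 1 + a 2 * b 2 := fun a b => by
    simp only [dotProduct, Fin.sum_univ_three]
  simp only [Fin.sum_univ_four, Matrix.cons_val]
  rw [← dotProduct_fin3 b₀ b₀, ← dotProduct_fin3 b₁ b₁, ← dotProduct_fin3 b₂ b₂, ← dotProduct_fin3 s s, ← dotProduct_fin3 b₀ b₁,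
    ← dotProduct_fin3 b₀ b₂, ← dotProduct_fin3 b₁ b₂, ← dotProduct_fin3 b₀ s, ← dotProduct_fin3 b₁ s, ← dotProduct_fin3 b₂ s,
    dotProduct_comm b₁ b₀, dotProduct_comm b₂ b₀, dotProduct_comm b₂ b₁, dotProduct_comm s b₀, dotProduct_comm s b₁, dotProduct_comm s b₂]
  nlinarith [mul_nonneg hc (lagrange_nonneg b₀ b₁), mul_nonneg hc (lagrange_nonneg b₀ b₂), mul_nonneg hc (lagrange_nonneg b₁ b₂),
    mul_nonneg hc (lagrange_nonneg b₀ s), mul_nonneg hc (lagrange_nonneg b₁ s), mul_nonneg hc (lagrange_nonneg b₂ s)]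

variable {L : ℕ} [NeZero L]

/-- ★★ **The block data of ANY ring history are within `√(2F₀(π_C P))/(L|z|)` of COMMUTING (collinear) data.**  With the four block data
`z = ((blockIm (wrapBlock k) k P)_{k<3}, seamIm P)` of the central chart and signs `σ, σ₄ ∈ {±1}`: there are an axis `a ∈ ℝ³` and scalars `t_μ` with
`(Σ_μ |z_μ − t_μ·a|²)·(Σ_μ |z_μ|²)·L² ≤ 2·F₀(π_C P)` (✓`ringDeficit_centralProj` + `exists_collinear_near`: the spatial pairs carry weight `8L²`, the seam pairs
`4L²`, so `2L²·Σ_μΣ_ν lag ≤ F₀(π_C P)`). [cite: CosteEtAl1985] -/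
theorem exists_collinear_near_centralProj {σ : Fin 3 → ℝ} {σ₄ : ℝ} (hσ : ∀ k, σ k = 1 ∨ σ k = -1) (hσ₄ : σ₄ = 1 ∨ σ₄ = -1)
    (P : (Fin (2 * L - 1 + 1) → GaugeConfig 3 L SU2) × (Site 3 L → SU2)) :
    ∃ (a : Fin 3 → ℝ) (t : Fin 4 → ℝ),
      (∑ μ : Fin 4, ((![blockIm L (wrapBlock L 0) 0 P, blockIm L (wrapBlock L 1) 1 P, blockIm L (wrapBlock L 2) 2 P, seamIm L P] :
          Fin 4 → Fin 3 → ℝ) μ - t μ • a) ⬝ᵥ ((![blockIm L (wrapBlock L 0) 0 P, blockIm L (wrapBlock L 1) 1 P, blockIm L (wrapBlock L 2) 2 P,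
          seamIm L P] : Fin 4 → Fin 3 → ℝ) μ - t μ • a)) *
        (∑ μ : Fin 4, ((![blockIm L (wrapBlock L 0) 0 P, blockIm L (wrapBlock L 1) 1 P, blockIm L (wrapBlock L 2) 2 P, seamIm L P] :
          Fin 4 → Fin 3 → ℝ) μ) ⬝ᵥ ((![blockIm L (wrapBlock L 0) 0 P, blockIm L (wrapBlock L 1) 1 P, blockIm L (wrapBlock L 2) 2 P, seamIm L P] :
          Fin 4 → Fin 3 → ℝ) μ)) * (L : ℝ) ^ 2 ≤
      2 * ringDeficit L (fun _ => false) (centralProj L σ σ₄ P) := by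
  have hL : (0 : ℝ) ≤ (L : ℝ) ^ 2 := by positivity
  obtain ⟨a, t, hcone⟩ := exists_collinear_near
    (![blockIm L (wrapBlock L 0) 0 P, blockIm L (wrapBlock L 1) 1 P, blockIm L (wrapBlock L 2) 2 P, seamIm L P] : Fin 4 → Fin 3 → ℝ)
  have hq := double_sum_le_weighted_quartic (blockIm L (wrapBlock L 0) 0 P) (blockIm L (wrapBlock L 1) 1 P) (blockIm L (wrapBlock L 2) 2 P)
    (seamIm L P) hL
  refine ⟨a, t, ?_⟩
  rw [ringDeficit_centralProj hσ hσ₄ P, sum_pairs_fin3, Fin.sum_univ_three]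
  rw [Fintype.card_fin] at hcone
  push_cast at hcone
  exact le_trans (mul_le_mul_of_nonneg_right hcone hL) hq

end Summit.QuantumFields.YangMills.Theorems.VirialFluxGap.BlockCone

end
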